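import Literature.AlgebraicTopology.Homotopy.SerreFibrationPreimages
import Literature.AlgebraicTopology.Homotopy.SkeletonCollar
import Literature.AlgebraicTopology.Homotopy.JCollapse
import Literature.AlgebraicTopology.SingularHomology.DiscAnnulusHomology
import Literature.AlgebraicTopology.SingularHomology.ExcisionTheorem
import HarnessLib

/-!
# Serre fibrations over a cube: `H_{n+m}(P, P|∂Iᵐ) ≅ H_n(P)`, naturally in fibrewise maps

Topic `Literature/AlgebraicTopology/Homotopy`. The single-cell computation in the `E¹`-term of the
spectral sequence of a fibration (E. H. Spanier, *Algebraic Topology* (1981), Ch. 9, Sec. 2,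
Thm. 15 (a): "`ψ_* : H_s(e, ė; Hₙ(F)) ≈ H_{n+s}(p⁻¹(e), p⁻¹(ė))`"; A. Hatcher, *Algebraic Topology*
(2002), §4.2 p. 376 and the spectral-sequences chapter, proof of Thm. 5.3: "the fibration over a
cell is (weakly) a product `Dˢ × F`"), in the form that needs neither a local trivialisation nor a
transport of fibres and therefore holds for SERRE fibrations: for a Serre fibration
`q : P → Iᵐ⁺¹` over the cube, with `∂ = ∂Iᵐ⁺¹ ⊇ J = ∂Iᵐ⁺¹ ∖ (free face `{y₀ = 0}`)`,

  `H_{n+1}(P, q⁻¹∂) —δ→ H_n(q⁻¹∂, q⁻¹J) ←ι— H_n(q⁻¹{y₀ = 0}, q⁻¹({y₀ = 0} ∩ J))`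

are isomorphisms (`δ`: the boundary of the triple, an isomorphism because `J ↪ Iᵐ⁺¹` is a weak
equivalence of sub-bases so `H_•(P, q⁻¹J) = 0`; `ι`: excision of the complement of a collar of the
free face inside `∂`, plus two collar deformations of sub-bases), and the free face with
`e ↦ tail (q e)` is again a Serre fibration over `Iᵐ` whose boundary preimage is `q⁻¹({y₀=0} ∩ J)`
and whose total space includes into `P` by a weak equivalence. By induction on `m` this gives,
for a FIBREWISE map `f : P → P'` of Serre fibrations over `Iᵐ` (`q' ∘ f = q`):

* `SerreCube.isZero_of_lt` — `H_n(P, q⁻¹∂Iᵐ; R) = 0` for `n < m`;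
* `SerreCube.isIso_map_iff`, `epi_map_iff`, `mono_map_iff` — **`f_* : H_{n+m}(P, q⁻¹∂Iᵐ) →
  H_{n+m}(P', q'⁻¹∂Iᵐ)` is an isomorphism (resp. onto, resp. injective) iff
  `f_* : H_n(P) → H_n(P')` is** (the naturality in `f` of Spanier's `ψ_*`, which is all the
  comparison theorems of the Serre spectral sequence use of it).

The only inputs on `q` are the weak equivalences `q⁻¹S ↪ q⁻¹T` over weakly equivalent sub-bases
`S ↪ T` (`IsSerreFibration.isWeakHomotopyEquiv_preimage_inclusion`,
`isZero_relativeSingularHomology_preimage`, file `SerreFibrationPreimages.lean`), excision and the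
exact sequence of a triple. Everything is proved; no named facts.

## References

* E. H. Spanier, *Algebraic Topology*, Springer (1981), Ch. 9, Sec. 2, Lemma 2, Thm. 15 (a).
  [Spanier1981]
* A. Hatcher, *Algebraic Topology*, CUP (2002), §4.2 p. 376; §2.1 p. 118 (triples), Thm. 2.20
  (excision). [HatcherAT2002]
-/

noncomputable section

open Set Function Metric unitInterval CategoryTheory CategoryTheory.Limits
open scoped Topology unitInterval Topology.Homotopy
open Literature.AlgebraicTopology.SingularHomology

namespace Literature.AlgebraicTopology.Homotopy

universe u uR

namespace SerreCube

/-! ### Geometry of the cube `Iᵐ⁺¹ = I × Iᵐ`: free face, `J`, the collar of the free face -/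

variable {m : ℕ}

/-- The free face `{y₀ = 0}` of `Iᵐ⁺¹`. [cite: HatcherAT2002, §4.1 p. 343] -/
def face (m : ℕ) : Set (Fin (m + 1) → I) := {y | y 0 = 0}

/-- `J = ∂Iᵐ⁺¹ ∖ (open free face)`: the lid `{y₀ = 1}` and the walls (`RelGenLoop.jBoundary 0`).
[cite: HatcherAT2002, §4.1 p. 343] -/
abbrev jb (m : ℕ) : Set (Fin (m + 1) → I) := RelGenLoop.jBoundary (0 : Fin (m + 1))

/-- The "rim norm" of a point of `Iᵐ`: its sup-distance from the centre, rescaled so that the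
boundary is `{rimNorm = 1}` (the norm of the corresponding point of the cube `[-1, 1]ᵐ`).
[folklore] -/
def rimNorm (y : Fin m → I) : ℝ := ‖(((closedBallHomeomorphCube m).symm y : ↥(closedBall (0 : Fin m → ℝ) 1)) : Fin m → ℝ)‖

/-- `rimNorm` is continuous. [folklore] -/
theorem continuous_rimNorm : Continuous (rimNorm (m := m)) :=
  continuous_norm.comp (continuous_subtype_val.comp (closedBallHomeomorphCube m).symm.continuous)

/-- `rimNorm y ≤ 1`. [folklore] -/
theorem rimNorm_le_one (y : Fin m → I) : rimNorm y ≤ 1 :=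
  mem_closedBall_zero_iff.1 ((closedBallHomeomorphCube m).symm y).2

/-- `rimNorm y = 1 ↔ y ∈ ∂Iᵐ`. [folklore] -/
theorem rimNorm_eq_one_iff (y : Fin m → I) : rimNorm y = 1 ↔ y ∈ Cube.boundary (Fin m) := by
  rw [rimNorm, ← mem_sphere_zero_iff_norm, closedBallHomeomorphCube_symm_mem_sphere_iff]

/-- The collar of the boundary of the free face inside the free face: `{y₀ = 0, rimNorm (tail y) ≥ ½}`.
[folklore] -/
def collar (m : ℕ) : Set (Fin (m + 1) → I) := {y | y 0 = 0 ∧ 2⁻¹ ≤ rimNorm (Fin.tail y)}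

/-- `J⁺ = J ∪ collar`, a neighbourhood of `J` in `∂Iᵐ⁺¹` deformation retracting onto `J`. [folklore] -/
def jbPlus (m : ℕ) : Set (Fin (m + 1) → I) := jb m ∪ collar m

/-- Membership in the free face. [folklore] -/
theorem mem_face_iff {y : Fin (m + 1) → I} : y ∈ face m ↔ y 0 = 0 := Iff.rfl

/-- Membership in `J` in head/tail coordinates. [folklore] -/
theorem mem_jb_iff (y : Fin (m + 1) → I) : y ∈ jb m ↔ y 0 = 1 ∨ Fin.tail y ∈ Cube.boundary (Fin m) :=
  JCollapse.mem_jBoundary_iff y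

/-- `∂Iᵐ⁺¹ = face ∪ J`. [folklore] -/
theorem mem_boundary_iff' (y : Fin (m + 1) → I) :
    y ∈ Cube.boundary (Fin (m + 1)) ↔ y 0 = 0 ∨ y ∈ jb m :=
  RelGenLoop.mem_boundary_iff 0 y

/-- The free face lies in `∂Iᵐ⁺¹`. [folklore] -/
theorem face_subset_boundary : face m ⊆ Cube.boundary (Fin (m + 1)) := fun _ hy =>
  (mem_boundary_iff' _).2 (Or.inl hy)

/-- `J ⊆ ∂Iᵐ⁺¹`. [folklore] -/
theorem jb_subset_boundary : jb m ⊆ Cube.boundary (Fin (m + 1)) := JCollapse.jBoundary_subset_boundary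

/-- The collar lies in the free face. [folklore] -/
theorem collar_subset_face : collar m ⊆ face m := fun _ hy => hy.1

/-- `J ⊆ J⁺`. [folklore] -/
theorem jb_subset_jbPlus : jb m ⊆ jbPlus m := subset_union_left

/-- `J⁺ ⊆ ∂Iᵐ⁺¹`. [folklore] -/
theorem jbPlus_subset_boundary : jbPlus m ⊆ Cube.boundary (Fin (m + 1)) :=
  union_subset jb_subset_boundary (collar_subset_face.trans face_subset_boundary)

/-- A point of the free face lies in `J` iff its tail is a boundary point of `Iᵐ`. [folklore] -/
theorem mem_jb_iff_of_mem_face {y : Fin (m + 1) → I} (hy : y ∈ face m) :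
    y ∈ jb m ↔ Fin.tail y ∈ Cube.boundary (Fin m) := by
  rw [mem_jb_iff, mem_face_iff.1 hy]
  exact ⟨fun h => h.resolve_left zero_ne_one, Or.inr⟩

/-- `face ∩ J ⊆ collar` (the boundary of the free face has rim norm `1`). [folklore] -/
theorem mem_collar_of_mem_face_of_mem_jb {y : Fin (m + 1) → I} (hy : y ∈ face m) (hy' : y ∈ jb m) :
    y ∈ collar m :=
  ⟨hy, by rw [(rimNorm_eq_one_iff _).2 ((mem_jb_iff_of_mem_face hy).1 hy')]; norm_num⟩

/-- The free face is closed. [folklore] -/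
theorem isClosed_face : IsClosed (face m) := isClosed_eq (continuous_apply 0) continuous_const

/-- `J` is closed. [folklore] -/
theorem isClosed_jb : IsClosed (jb m) := JCollapse.isClosed_jBoundary

/-! ### The collar deformation `G` of the cube -/

/-- The radial push of `Iᵐ` read through `Iᵐ ≅ [-1, 1]ᵐ`: identity at `t = 0` and on `∂Iᵐ`,
rim norm `≥ ½` preserved, and at `t = 1` the rim `{rimNorm ≥ ½}` lands on `∂Iᵐ`. [folklore] -/
def push (t : I) (y : Fin m → I) : Fin m → I :=
  closedBallHomeomorphCube m ⟨SkeletonCollar.radial t ((closedBallHomeomorphCube m).symm y),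
    SkeletonCollar.radial_mem_closedBall t.2.1 t.2.2 (mem_closedBall_zero_iff.1 ((closedBallHomeomorphCube m).symm y).2)⟩

/-- The radial push is jointly continuous. [folklore] -/
theorem continuous_push : Continuous fun p : I × (Fin m → I) => push p.1 p.2 := by
  refine (closedBallHomeomorphCube m).continuous.comp (Continuous.subtype_mk ?_ _)
  exact SkeletonCollar.continuous_radial.comp ((continuous_subtype_val.comp continuous_fst).prodMk
    (continuous_subtype_val.comp ((closedBallHomeomorphCube m).symm.continuous.comp continuous_snd)))

/-- At `t = 0` the push is the identity. [folklore] -/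
@[simp] theorem push_zero (y : Fin m → I) : push 0 y = y := by
  simp [push]

/-- The push fixes `∂Iᵐ` pointwise. [folklore] -/
theorem push_of_mem_boundary (t : I) {y : Fin m → I} (hy : y ∈ Cube.boundary (Fin m)) : push t y = y := by
  have h1 : ‖(((closedBallHomeomorphCube m).symm y : ↥(closedBall (0 : Fin m → ℝ) 1)) : Fin m → ℝ)‖ = 1 :=
    (rimNorm_eq_one_iff y).2 hy
  have : (⟨SkeletonCollar.radial t ((closedBallHomeomorphCube m).symm y),
      SkeletonCollar.radial_mem_closedBall t.2.1 t.2.2 (mem_closedBall_zero_iff.1 ((closedBallHomeomorphCube m).symm y).2)⟩ :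
      ↥(closedBall (0 : Fin m → ℝ) 1)) = (closedBallHomeomorphCube m).symm y :=
    Subtype.ext (SkeletonCollar.radial_of_norm_eq_one _ h1)
  rw [push, this, Homeomorph.apply_symm_apply]

/-- The rim norm of a pushed point. [folklore] -/
theorem rimNorm_push (t : I) (y : Fin m → I) :
    rimNorm (push t y) = ‖SkeletonCollar.radial (t : ℝ) (((closedBallHomeomorphCube m).symm y : ↥(closedBall (0 : Fin m → ℝ) 1)) : Fin m → ℝ)‖ := by
  rw [rimNorm, push, Homeomorph.symm_apply_apply]

/-- The push preserves the rim `{rimNorm ≥ ½}`. [folklore] -/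
theorem half_le_rimNorm_push (t : I) {y : Fin m → I} (hy : 2⁻¹ ≤ rimNorm y) : 2⁻¹ ≤ rimNorm (push t y) := by
  rw [rimNorm_push]
  exact (SkeletonCollar.half_le_norm_radial t.2.1 t.2.2 hy (rimNorm_le_one y)).1

/-- At `t = 1` the rim lands on `∂Iᵐ`. [folklore] -/
theorem push_one_mem_boundary {y : Fin m → I} (hy : 2⁻¹ ≤ rimNorm y) : push 1 y ∈ Cube.boundary (Fin m) := by
  rw [← rimNorm_eq_one_iff, rimNorm_push]
  exact SkeletonCollar.norm_radial_one hy

/-- The radial push as a bundled map `I × Iᵐ → Iᵐ` (bundled so that compositions elaborate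
cheaply). [folklore] -/
def pushMap (m : ℕ) : C(I × (Fin m → I), Fin m → I) := ⟨fun p => push p.1 p.2, continuous_push⟩

/-- `pushMap` is `push`. [folklore] -/
@[simp] theorem pushMap_apply (t : I) (y : Fin m → I) : pushMap m (t, y) = push t y := rfl

/-- **The collar deformation of `Iᵐ⁺¹`**: `G(t, y) = (y₀, push_{min(t, 1 - y₀)} (tail y))`. It is the
identity at `t = 0`, fixes `J` pointwise (the lid because the time is damped to `0` there, the walls
because `push` fixes `∂Iᵐ`), preserves `y₀`, the collar and `J⁺`, and at `t = 1` carries the collar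
into `J`. [folklore] -/
def G (m : ℕ) : C(I × (Fin (m + 1) → I), Fin (m + 1) → I) where
  toFun p := Fin.cons (α := fun _ : Fin (m + 1) => I) (p.2 0) (pushMap m (min p.1 (σ (p.2 0)), (Fin.tail p.2 : Fin m → I)))
  continuous_toFun := by
    have hhead : Continuous fun p : I × (Fin (m + 1) → I) => p.2 0 := (continuous_apply 0).comp continuous_snd
    have hmin : Continuous fun p : I × (Fin (m + 1) → I) => min p.1 (σ (p.2 0)) :=
      continuous_fst.min (unitInterval.continuous_symm.comp hhead)
    have htail : Continuous fun p : I × (Fin (m + 1) → I) => (Fin.tail p.2 : Fin m → I) :=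
      (continuous_pi fun j : Fin m => continuous_apply (Fin.succ j)).comp continuous_snd
    have hpush : Continuous fun p : I × (Fin (m + 1) → I) => pushMap m (min p.1 (σ (p.2 0)), (Fin.tail p.2 : Fin m → I)) :=
      (pushMap m).continuous.comp (hmin.prodMk htail)
    exact hhead.finCons hpush

/-- The formula for `G`. [folklore] -/
theorem G_apply (t : I) (y : Fin (m + 1) → I) :
    G m (t, y) = Fin.cons (α := fun _ : Fin (m + 1) => I) (y 0) (push (min t (σ (y 0))) (Fin.tail y)) := rfl

/-- `G` preserves the head coordinate. [folklore] -/
@[simp] theorem G_apply_zero (t : I) (y : Fin (m + 1) → I) : G m (t, y) 0 = y 0 := by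
  rw [G_apply, Fin.cons_zero]

/-- The tail of `G`. [folklore] -/
theorem tail_G (t : I) (y : Fin (m + 1) → I) : Fin.tail (G m (t, y)) = push (min t (σ (y 0))) (Fin.tail y) := by
  rw [G_apply, Fin.tail_cons]

/-- `G` starts at the identity. [folklore] -/
@[simp] theorem G_zero (y : Fin (m + 1) → I) : G m (0, y) = y := by
  rw [G_apply]
  have : min (0 : I) (σ (y 0)) = 0 := min_eq_left unitInterval.nonneg'
  rw [this, push_zero, Fin.cons_self_tail]

/-- `G` fixes `J` pointwise. [folklore] -/
theorem G_of_mem_jb (t : I) {y : Fin (m + 1) → I} (hy : y ∈ jb m) : G m (t, y) = y := by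
  rw [G_apply]
  rcases (mem_jb_iff y).1 hy with h | h
  · have : min t (σ (y 0)) = 0 := by rw [h, unitInterval.symm_one]; exact min_eq_right unitInterval.nonneg'
    rw [this, push_zero, Fin.cons_self_tail]
  · rw [push_of_mem_boundary _ h, Fin.cons_self_tail]

/-- On the free face the time is not damped: `G(t, y) = (0, pushₜ (tail y))`. [folklore] -/
theorem G_of_mem_face (t : I) {y : Fin (m + 1) → I} (hy : y ∈ face m) :
    G m (t, y) = Fin.cons (α := fun _ : Fin (m + 1) => I) (y 0) (push t (Fin.tail y)) := by
  rw [G_apply, mem_face_iff.1 hy, unitInterval.symm_zero, min_eq_left unitInterval.le_one']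

/-- `G` preserves the free face. [folklore] -/
theorem G_mem_face {t : I} {y : Fin (m + 1) → I} (hy : y ∈ face m) : G m (t, y) ∈ face m := by
  rw [mem_face_iff, G_apply_zero]; exact hy

/-- `G` preserves the collar. [folklore] -/
theorem G_mem_collar {t : I} {y : Fin (m + 1) → I} (hy : y ∈ collar m) : G m (t, y) ∈ collar m := by
  refine ⟨G_mem_face hy.1, ?_⟩
  rw [tail_G]
  exact half_le_rimNorm_push _ hy.2

/-- `G` preserves `J⁺`. [folklore] -/
theorem G_mem_jbPlus {t : I} {y : Fin (m + 1) → I} (hy : y ∈ jbPlus m) : G m (t, y) ∈ jbPlus m := by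
  rcases hy with hy | hy
  · rw [G_of_mem_jb t hy]; exact Or.inl hy
  · exact Or.inr (G_mem_collar hy)

/-- At `t = 1` the collar is carried into `J` (indeed onto `face ∩ J`). [folklore] -/
theorem G_one_mem_jb {y : Fin (m + 1) → I} (hy : y ∈ collar m) : G m (1, y) ∈ jb m := by
  rw [mem_jb_iff_of_mem_face (G_mem_face hy.1), tail_G, mem_face_iff.1 hy.1, unitInterval.symm_zero,
    min_self]
  exact push_one_mem_boundary hy.2

/-- **`J` is a strong deformation retract of `J⁺ = J ∪ collar`.** [folklore] -/
theorem isStrongDeformationRetractOf_jb_jbPlus : IsStrongDeformationRetractOf (jb m) (jbPlus m) := by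
  refine ⟨⟨fun p => ⟨G m (p.1, (p.2 : Fin (m + 1) → I)), G_mem_jbPlus p.2.2⟩,
    ((G m).continuous.comp (continuous_fst.prodMk (continuous_subtype_val.comp continuous_snd))).subtype_mk _⟩,
    fun y => Subtype.ext (G_zero _), fun y => ?_, fun t y hy => Subtype.ext (G_of_mem_jb t hy)⟩
  rcases y.2 with hy | hy
  · show G m (1, (y : Fin (m + 1) → I)) ∈ jb m
    rw [G_of_mem_jb 1 hy]; exact hy
  · exact G_one_mem_jb hy

/-- **`face ∩ J` is a strong deformation retract of `face ∩ J⁺`** (the collar of the boundary of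
the free face retracts onto that boundary). [folklore] -/
theorem isStrongDeformationRetractOf_face_inter :
    IsStrongDeformationRetractOf (face m ∩ jb m) (face m ∩ jbPlus m) := by
  refine ⟨⟨fun p => ⟨G m (p.1, (p.2 : Fin (m + 1) → I)), G_mem_face (mem_of_mem_inter_left p.2.2),
      G_mem_jbPlus (mem_of_mem_inter_right p.2.2)⟩,
    ((G m).continuous.comp (continuous_fst.prodMk (continuous_subtype_val.comp continuous_snd))).subtype_mk _⟩,
    fun y => Subtype.ext (G_zero _), fun y => ⟨G_mem_face (mem_of_mem_inter_left y.2), ?_⟩,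
    fun t y hy => Subtype.ext (G_of_mem_jb t (mem_of_mem_inter_right hy))⟩
  show G m (1, (y : Fin (m + 1) → I)) ∈ jb m
  rcases mem_of_mem_inter_right y.2 with hy | hy
  · rw [G_of_mem_jb 1 hy]; exact hy
  · exact G_one_mem_jb hy

/-! ### Contractibility: `Iᵐ⁺¹`, the free face and `J`; weak equivalences of sub-bases -/

/-- Any two maps into a contractible space are homotopic. [folklore] -/
theorem homotopic_of_contractibleSpace' {X Y : Type*} [TopologicalSpace X] [TopologicalSpace Y]
    [ContractibleSpace Y] (f g : C(X, Y)) : f.Homotopic g := by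
  obtain ⟨y₀, hy₀⟩ := id_nullhomotopic Y
  have hf : f.Homotopic (ContinuousMap.const X y₀) := by
    simpa using hy₀.comp (ContinuousMap.Homotopic.refl f)
  have hg : g.Homotopic (ContinuousMap.const X y₀) := by
    simpa using hy₀.comp (ContinuousMap.Homotopic.refl g)
  exact hf.trans hg.symm

/-- The inclusion of a nonempty contractible subspace into a contractible subspace is a weak
homotopy equivalence. [folklore] -/
theorem isWeakHomotopyEquiv_subsetInclusion_of_contractible {X : Type*} [TopologicalSpace X]
    {A S : Set X} (h : A ⊆ S) [ContractibleSpace A] [ContractibleSpace S] :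
    IsWeakHomotopyEquiv (subsetInclusion h) := by
  obtain ⟨eA⟩ := ContractibleSpace.hequiv_unit A
  obtain ⟨eS⟩ := ContractibleSpace.hequiv_unit S
  let e : ContinuousMap.HomotopyEquiv A S := eA.trans eS.symm
  exact isWeakHomotopyEquiv_of_homotopic (homotopic_of_contractibleSpace' _ _)
    (isWeakHomotopyEquiv_homotopyEquiv e)

/-- The cube `Iⁿ` is contractible (straight-line contraction read through `Iⁿ ≅ [-1, 1]ⁿ`). [folklore] -/
theorem contractibleSpace_cube (n : ℕ) : ContractibleSpace (Fin n → I) :=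
  ((closedBallHomeomorphCube n).symm.contractibleSpace_iff).2
    ((convex_closedBall (0 : Fin n → ℝ) 1).contractibleSpace ⟨0, mem_closedBall_self zero_le_one⟩)

/-- `Iᵐ⁺¹` (as the subset `univ`) is contractible. [folklore] -/
theorem contractibleSpace_univ : ContractibleSpace ↥(univ : Set (Fin (m + 1) → I)) :=
  haveI := contractibleSpace_cube (m + 1)
  (Homeomorph.Set.univ (Fin (m + 1) → I)).contractibleSpace

/-- The free face is a cube `Iᵐ` (`y ↦ tail y`, `y' ↦ (0, y')`). [folklore] -/
def faceHomeomorph (m : ℕ) : ↥(face m) ≃ₜ (Fin m → I) where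
  toFun y := Fin.tail (y : Fin (m + 1) → I)
  invFun y' := ⟨Fin.cons 0 y', by simp [mem_face_iff]⟩
  left_inv y := Subtype.ext (by
    have h0 : (y : Fin (m + 1) → I) 0 = 0 := y.2
    simp only
    conv_rhs => rw [← Fin.cons_self_tail (y : Fin (m + 1) → I), h0])
  right_inv y' := Fin.tail_cons _ _
  continuous_toFun := (continuous_pi fun j : Fin m => continuous_apply (Fin.succ j)).comp continuous_subtype_val
  continuous_invFun := by
    refine Continuous.subtype_mk (continuous_pi fun i => ?_) _
    refine Fin.cases ?_ (fun j => ?_) i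
    · simp only [Fin.cons_zero]; exact continuous_const
    · simp only [Fin.cons_succ]; exact continuous_apply j

/-- The free face is contractible. [folklore] -/
theorem contractibleSpace_face : ContractibleSpace ↥(face m) :=
  haveI := contractibleSpace_cube m
  (faceHomeomorph m).contractibleSpace

/-- `J` is contractible: for `m ≥ 1` by the contraction of `J` inside `J`
(`JCollapse.contractJ`), for `m = 0` it is the point `{1}`. [cite: HatcherAT2002, §4.1 p. 343] -/
theorem contractibleSpace_jb : ∀ m : ℕ, ContractibleSpace ↥(jb m)
  | 0 => by
    have h1 : ∀ y : ↥(jb 0), (y : Fin 1 → I) = fun _ => 1 := fun y => by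
      rcases (mem_jb_iff (y : Fin 1 → I)).1 y.2 with h | ⟨i, _⟩
      · funext i; rw [show i = 0 from Fin.eq_zero i]; exact h
      · exact i.elim0
    haveI : Subsingleton ↥(jb 0) := ⟨fun a b => Subtype.ext ((h1 a).trans (h1 b).symm)⟩
    haveI : Nonempty ↥(jb 0) := ⟨⟨fun _ => 1, (mem_jb_iff _).2 (Or.inl rfl)⟩⟩
    infer_instance
  | m + 1 => by
    rw [contractible_iff_id_nullhomotopic]
    refine ⟨⟨0, JCollapse.zero_mem_jBoundary⟩, ⟨?_⟩⟩
    exact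
      { toFun := fun p => ⟨JCollapse.contractJ (p.1, (p.2 : Fin (m + 2) → I)),
          JCollapse.contractJ_mem_jBoundary p.1 p.2.2⟩
        continuous_toFun := (JCollapse.contractJ.continuous.comp
          (continuous_fst.prodMk (continuous_subtype_val.comp continuous_snd))).subtype_mk _
        map_zero_left := fun y => Subtype.ext (JCollapse.contractJ_zero _)
        map_one_left := fun y => Subtype.ext (JCollapse.contractJ_one _) }

/-- **`J ↪ Iᵐ⁺¹` is a weak homotopy equivalence** (both are contractible). [folklore] -/
theorem isWeakHomotopyEquiv_jb_univ :
    IsWeakHomotopyEquiv (subsetInclusion (subset_univ (jb m))) :=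
  haveI := contractibleSpace_jb m
  haveI := contractibleSpace_univ (m := m)
  isWeakHomotopyEquiv_subsetInclusion_of_contractible _

/-- **The free face `↪ Iᵐ⁺¹` is a weak homotopy equivalence.** [folklore] -/
theorem isWeakHomotopyEquiv_face_univ :
    IsWeakHomotopyEquiv (subsetInclusion (subset_univ (face m))) :=
  haveI := contractibleSpace_face (m := m)
  haveI := contractibleSpace_univ (m := m)
  isWeakHomotopyEquiv_subsetInclusion_of_contractible _

/-- `J ↪ J⁺` is a weak homotopy equivalence. [folklore] -/
theorem isWeakHomotopyEquiv_jb_jbPlus :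
    IsWeakHomotopyEquiv (subsetInclusion (jb_subset_jbPlus (m := m))) :=
  isWeakHomotopyEquiv_subsetInclusion_of_isStrongDeformationRetractOf isStrongDeformationRetractOf_jb_jbPlus _

/-- `face ∩ J ↪ face ∩ J⁺` is a weak homotopy equivalence. [folklore] -/
theorem isWeakHomotopyEquiv_face_inter :
    IsWeakHomotopyEquiv (subsetInclusion (inter_subset_inter_right (face m) (jb_subset_jbPlus (m := m)))) :=
  isWeakHomotopyEquiv_subsetInclusion_of_isStrongDeformationRetractOf isStrongDeformationRetractOf_face_inter _

/-! ### Two open sets of the cube exhibiting the excision `(face, face ∩ J⁺) ↪ (∂, J⁺)` -/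

/-- `U₁ = {y₀ < ½, tail y in the open cube}`: open, and `U₁ ∩ ∂ ⊆ face`. [folklore] -/
def U₁ (m : ℕ) : Set (Fin (m + 1) → I) := {y | (y 0 : ℝ) < 2⁻¹} ∩ {y | rimNorm (Fin.tail y) < 1}

/-- `U₂ = {0 < y₀} ∪ {½ < rimNorm (tail y)}`: open, and `U₂ ∩ ∂ ⊆ J⁺`. [folklore] -/
def U₂ (m : ℕ) : Set (Fin (m + 1) → I) := {y | 0 < (y 0 : ℝ)} ∪ {y | 2⁻¹ < rimNorm (Fin.tail y)}

/-- `tail` is continuous. [folklore] -/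
theorem continuous_tail' : Continuous fun y : Fin (m + 1) → I => Fin.tail y :=
  continuous_pi fun j : Fin m => continuous_apply (Fin.succ j)

/-- The head coordinate (as a real number) is continuous. [folklore] -/
theorem continuous_coe_apply_zero : Continuous fun y : Fin (m + 1) → I => ((y 0 : I) : ℝ) :=
  continuous_subtype_val.comp (continuous_apply 0)

/-- The rim norm of the tail is continuous. [folklore] -/
theorem continuous_rimNorm_tail : Continuous fun y : Fin (m + 1) → I => rimNorm (Fin.tail y) :=
  continuous_rimNorm.comp continuous_tail'

/-- `U₁` is open. [folklore] -/
theorem isOpen_U₁ : IsOpen (U₁ m) :=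
  (isOpen_lt continuous_coe_apply_zero continuous_const).inter
    (isOpen_lt continuous_rimNorm_tail continuous_const)

/-- `U₂` is open. [folklore] -/
theorem isOpen_U₂ : IsOpen (U₂ m) :=
  (isOpen_lt continuous_const continuous_coe_apply_zero).union
    (isOpen_lt continuous_const continuous_rimNorm_tail)

/-- `U₁ ∪ U₂` is the whole cube. [folklore] -/
theorem U₁_union_U₂ : U₁ m ∪ U₂ m = univ := by
  refine eq_univ_of_forall fun y => ?_
  by_cases h0 : 0 < (y 0 : ℝ)
  · exact Or.inr (Or.inl h0)
  · have hy0 : (y 0 : ℝ) = 0 := le_antisymm (not_lt.1 h0) (y 0).2.1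
    by_cases h1 : rimNorm (Fin.tail y) < 1
    · exact Or.inl ⟨show ((y 0 : I) : ℝ) < 2⁻¹ by rw [hy0]; norm_num, h1⟩
    · refine Or.inr (Or.inr ?_)
      have : rimNorm (Fin.tail y) = 1 := le_antisymm (rimNorm_le_one _) (not_lt.1 h1)
      change 2⁻¹ < rimNorm (Fin.tail y)
      rw [this]; norm_num

/-- `U₁ ∩ ∂Iᵐ⁺¹ ⊆ face`. [folklore] -/
theorem mem_face_of_mem_U₁ {y : Fin (m + 1) → I} (hy : y ∈ U₁ m) (hb : y ∈ Cube.boundary (Fin (m + 1))) :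
    y ∈ face m := by
  rcases (JCollapse.mem_boundary_iff y).1 hb with (h | h) | h
  · exact h
  · exfalso
    have h' : ((y 0 : I) : ℝ) < 2⁻¹ := hy.1
    rw [h] at h'; norm_num at h'
  · exfalso; exact (lt_irrefl (1 : ℝ)) (((rimNorm_eq_one_iff _).2 h) ▸ hy.2)

/-- `U₂ ∩ ∂Iᵐ⁺¹ ⊆ J⁺`. [folklore] -/
theorem mem_jbPlus_of_mem_U₂ {y : Fin (m + 1) → I} (hy : y ∈ U₂ m) (hb : y ∈ Cube.boundary (Fin (m + 1))) :
    y ∈ jbPlus m := by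
  rcases (mem_boundary_iff' y).1 hb with h0 | hj
  · rcases hy with h | h
    · exfalso
      have h' : 0 < ((y 0 : I) : ℝ) := h
      rw [h0] at h'; exact lt_irrefl _ h'
    · exact Or.inr ⟨h0, le_of_lt (show 2⁻¹ < rimNorm (Fin.tail y) from h)⟩
  · exact Or.inl hj


/-! ### Squares with two isomorphic sides -/

section Square

variable {C : Type*} [Category C] {A B A' B' : C} {f : A ⟶ B} {g : A' ⟶ B'} (a : A ⟶ A') (b : B ⟶ B')

/-- In a commutative square whose horizontal sides are isomorphisms, one vertical side is an
isomorphism iff the other is. [folklore] -/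
theorem isIso_iff_of_square [IsIso a] [IsIso b] (sq : f ≫ b = a ≫ g) : IsIso f ↔ IsIso g := by
  constructor
  · intro hf
    have : g = inv a ≫ f ≫ b := by rw [sq, IsIso.inv_hom_id_assoc]
    rw [this]; infer_instance
  · intro hg
    have : f = a ≫ g ≫ inv b := by rw [← Category.assoc, ← sq, Category.assoc, IsIso.hom_inv_id, Category.comp_id]
    rw [this]; infer_instance

/-- In a commutative square whose horizontal sides are isomorphisms, one vertical side is onto
iff the other is. [folklore] -/
theorem epi_iff_of_square [IsIso a] [IsIso b] (sq : f ≫ b = a ≫ g) : Epi f ↔ Epi g := by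
  constructor
  · intro hf
    have : g = inv a ≫ f ≫ b := by rw [sq, IsIso.inv_hom_id_assoc]
    rw [this]; infer_instance
  · intro hg
    have : f = a ≫ g ≫ inv b := by rw [← Category.assoc, ← sq, Category.assoc, IsIso.hom_inv_id, Category.comp_id]
    rw [this]; infer_instance

/-- In a commutative square whose horizontal sides are isomorphisms, one vertical side is
injective iff the other is. [folklore] -/
theorem mono_iff_of_square [IsIso a] [IsIso b] (sq : f ≫ b = a ≫ g) : Mono f ↔ Mono g := by
  constructor
  · intro hf
    have : g = inv a ≫ f ≫ b := by rw [sq, IsIso.inv_hom_id_assoc]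
    rw [this]; infer_instance
  · intro hg
    have : f = a ≫ g ≫ inv b := by rw [← Category.assoc, ← sq, Category.assoc, IsIso.hom_inv_id, Category.comp_id]
    rw [this]; infer_instance

end Square

/-! ### Relative homology of a Serre fibration over `Iᵐ⁺¹`: the isomorphisms `δ` and `ι` -/

section Fibration

variable (R : Type uR) [CommRing R]
variable {P : Type u} [TopologicalSpace P] {q : P → (Fin (m + 1) → I)}

/-- `q⁻¹∂Iᵐ⁺¹`. [folklore] -/
abbrev bdP (q : P → (Fin (m + 1) → I)) : Set P := q ⁻¹' Cube.boundary (Fin (m + 1))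

/-- `q⁻¹J`. [folklore] -/
abbrev jbP (q : P → (Fin (m + 1) → I)) : Set P := q ⁻¹' jb m

/-- `q⁻¹(free face)`, a subtype of `P`. [folklore] -/
abbrev FaceP (q : P → (Fin (m + 1) → I)) : Type u := ↥(q ⁻¹' face m)

omit [TopologicalSpace P] in
/-- `q⁻¹J ⊆ q⁻¹∂`. [folklore] -/
theorem jbP_subset_bdP : jbP q ⊆ bdP q := preimage_mono jb_subset_boundary

/-- **`H_•(P, q⁻¹J) = 0`**: `J ↪ Iᵐ⁺¹` is a weak equivalence of sub-bases. [cite: Spanier1981, Ch. 9, Sec. 2, Thm. 17] -/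
theorem isZero_rel_jbP (hq : IsSerreFibration q) (i : ℕ) : IsZero (relativeSingularHomology R R P (jbP q) i) := by
  have h := hq.isZero_relativeSingularHomology_preimage (subset_univ (jb m)) isWeakHomotopyEquiv_jb_univ R i
  let e : ↥(q ⁻¹' (univ : Set (Fin (m + 1) → I))) ≃ₜ P := Homeomorph.Set.univ P
  exact h.of_iso (relativeSingularHomology.mapHomeomorph R R e (fun z hz => hz) (fun z hz => hz) i).symm

/-- **`δ : H_{n+1}(P, q⁻¹∂) ≅ H_n(q⁻¹∂, q⁻¹J)`**, the boundary of the triple `(P, q⁻¹∂, q⁻¹J)`.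
[cite: HatcherAT2002, §2.1 p. 118 (exact sequence of a triple)] -/
theorem isIso_tripleδ (hq : IsSerreFibration q) (n : ℕ) :
    IsIso (relativeSingularHomology.tripleδ R R P (bdP q) (jbP q) n) := by
  have h3 := relativeSingularHomology.triple_exact₃ R R (jbP_subset_bdP (q := q)) n
  have h1 := relativeSingularHomology.triple_exact₁ R R (jbP_subset_bdP (q := q)) n
  haveI : Mono (relativeSingularHomology.tripleδ R R P (bdP q) (jbP q) n) :=
    h3.mono_g ((isZero_rel_jbP R hq (n + 1)).eq_of_src _ _)
  haveI : Epi (relativeSingularHomology.tripleδ R R P (bdP q) (jbP q) n) :=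
    h1.epi_f ((isZero_rel_jbP R hq n).eq_of_tgt _ _)
  exact isIso_of_mono_of_epi _

/-- The inclusion `q⁻¹(free face) → q⁻¹∂`. [folklore] -/
def faceIncl (q : P → (Fin (m + 1) → I)) : C(FaceP q, ↥(bdP q)) :=
  ⟨fun e => ⟨e.1, face_subset_boundary e.2⟩, (continuous_subtype_val).subtype_mk _⟩

/-- `faceIncl` maps `q⁻¹(face ∩ J)` into `q⁻¹J`. [folklore] -/
theorem mapsTo_faceIncl :
    MapsTo (faceIncl q) (Subtype.val ⁻¹' (q ⁻¹' jb m)) (Subtype.val ⁻¹' (jbP q)) := fun _ hz => hz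

/-- `faceIncl` maps `q⁻¹(face ∩ J⁺)` into `q⁻¹J⁺`. [folklore] -/
theorem mapsTo_faceIncl_plus :
    MapsTo (faceIncl q) (Subtype.val ⁻¹' (q ⁻¹' jbPlus m)) (Subtype.val ⁻¹' (q ⁻¹' jbPlus m)) := fun _ hz => hz

/-- `faceIncl` maps `q⁻¹(face ∩ J)` into `q⁻¹J⁺`. [folklore] -/
theorem mapsTo_faceIncl_jb_plus :
    MapsTo (faceIncl q) (Subtype.val ⁻¹' (q ⁻¹' jb m)) (Subtype.val ⁻¹' (q ⁻¹' jbPlus m)) := fun _ hz =>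
  jb_subset_jbPlus hz

omit [TopologicalSpace P] in
/-- `q⁻¹J ⊆ q⁻¹J⁺` inside `q⁻¹∂`. [folklore] -/
theorem jb_sub_plus_bd : (Subtype.val ⁻¹' (jbP q) : Set ↥(bdP q)) ⊆ Subtype.val ⁻¹' (q ⁻¹' jbPlus m) :=
  fun _ hz => jb_subset_jbPlus hz

omit [TopologicalSpace P] in
/-- `q⁻¹(face ∩ J) ⊆ q⁻¹(face ∩ J⁺)` inside `q⁻¹face`. [folklore] -/
theorem jb_sub_plus_face : (Subtype.val ⁻¹' (q ⁻¹' jb m) : Set (FaceP q)) ⊆ Subtype.val ⁻¹' (q ⁻¹' jbPlus m) :=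
  fun _ hz => jb_subset_jbPlus hz

/-- `H_n(q⁻¹∂, q⁻¹J) ≅ H_n(q⁻¹∂, q⁻¹J⁺)` (`J ↪ J⁺` is a weak equivalence of sub-bases).
[cite: Spanier1981, Ch. 9, Sec. 2, Thm. 17] -/
theorem isIso_jplus (hq : IsSerreFibration q) (n : ℕ) :
    IsIso (relativeSingularHomology.map R R (ContinuousMap.id ↥(bdP q)) (mapsTo_id_of_subset (jb_sub_plus_bd (q := q))) n) := by
  refine relativeSingularHomology.isIso_map_of_isZero R R (jb_sub_plus_bd (q := q)) (fun i => ?_) n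
  have h := hq.isZero_relativeSingularHomology_preimage (jb_subset_jbPlus (m := m)) isWeakHomotopyEquiv_jb_jbPlus R i
  let e : ↥(q ⁻¹' jbPlus m) ≃ₜ ↥(Subtype.val ⁻¹' (q ⁻¹' jbPlus m) : Set ↥(bdP q)) :=
    (preimageValHomeomorphOfSubset (preimage_mono jbPlus_subset_boundary : q ⁻¹' jbPlus m ⊆ bdP q)).symm
  exact h.of_iso (relativeSingularHomology.mapHomeomorph R R e (fun z hz => hz) (fun z hz => hz) i).symm

/-- `H_n(q⁻¹face, q⁻¹(face ∩ J)) ≅ H_n(q⁻¹face, q⁻¹(face ∩ J⁺))` (`face ∩ J ↪ face ∩ J⁺` is a weak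
equivalence of sub-bases). [cite: Spanier1981, Ch. 9, Sec. 2, Thm. 17] -/
theorem isIso_kplus (hq : IsSerreFibration q) (n : ℕ) :
    IsIso (relativeSingularHomology.map R R (ContinuousMap.id (FaceP q)) (mapsTo_id_of_subset (jb_sub_plus_face (q := q))) n) := by
  refine relativeSingularHomology.isIso_map_of_isZero R R (jb_sub_plus_face (q := q)) (fun i => ?_) n
  have h := hq.isZero_relativeSingularHomology_preimage
    (inter_subset_inter_right (face m) (jb_subset_jbPlus (m := m))) isWeakHomotopyEquiv_face_inter R i
  let e : ↥(q ⁻¹' (face m ∩ jbPlus m)) ≃ₜ ↥(Subtype.val ⁻¹' (q ⁻¹' jbPlus m) : Set (FaceP q)) :=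
    { toFun := fun z => (⟨⟨z.1, z.2.1⟩, z.2.2⟩ : ↥(Subtype.val ⁻¹' (q ⁻¹' jbPlus m) : Set (FaceP q)))
      invFun := fun w => (⟨w.1.1, ⟨w.1.2, w.2⟩⟩ : ↥(q ⁻¹' (face m ∩ jbPlus m)))
      left_inv := fun _ => rfl
      right_inv := fun _ => rfl
      continuous_toFun := ((continuous_subtype_val).subtype_mk _).subtype_mk _
      continuous_invFun := (continuous_subtype_val.comp continuous_subtype_val).subtype_mk _ }
  have he : MapsTo e (Subtype.val ⁻¹' (q ⁻¹' (face m ∩ jb m)))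
      (Subtype.val ⁻¹' (Subtype.val ⁻¹' (q ⁻¹' jb m))) :=
    fun (z : ↥(q ⁻¹' (face m ∩ jbPlus m))) (hz : q z.1 ∈ face m ∩ jb m) => hz.2
  have he' : MapsTo e.symm (Subtype.val ⁻¹' (Subtype.val ⁻¹' (q ⁻¹' jb m)))
      (Subtype.val ⁻¹' (q ⁻¹' (face m ∩ jb m))) :=
    fun (w : ↥(Subtype.val ⁻¹' (q ⁻¹' jbPlus m) : Set (FaceP q))) (hw : q w.1.1 ∈ jb m) => ⟨w.1.2, hw⟩
  exact h.of_iso (relativeSingularHomology.mapHomeomorph R R e he he' i).symm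

/-- **Excision: `H_n(q⁻¹face, q⁻¹(face ∩ J⁺)) ≅ H_n(q⁻¹∂, q⁻¹J⁺)`** — the preimages of the open
sets `U₁`, `U₂` of the cube exhibit the interiors of `q⁻¹face` and `q⁻¹J⁺` covering `q⁻¹∂`.
[cite: HatcherAT2002, Thm. 2.20 (excision)] -/
theorem isIso_exc (hq : IsSerreFibration q) (n : ℕ) :
    IsIso (relativeSingularHomology.map R R (faceIncl q) (mapsTo_faceIncl_plus (q := q)) n) := by
  -- the excision isomorphism for `A = q⁻¹J⁺`, `B = q⁻¹ face` inside `X₁ = q⁻¹∂`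
  set A : Set ↥(bdP q) := Subtype.val ⁻¹' (q ⁻¹' jbPlus m) with hA
  set B : Set ↥(bdP q) := Subtype.val ⁻¹' (q ⁻¹' face m) with hB
  have hqc : Continuous fun z : ↥(bdP q) => q z.1 := hq.continuous.comp continuous_subtype_val
  have hcov : interior A ∪ interior B = univ := by
    refine eq_univ_of_forall fun z => ?_
    have hz : q z.1 ∈ U₁ m ∪ U₂ m := by rw [U₁_union_U₂]; exact mem_univ _
    rcases hz with h | h
    · refine Or.inr (interior_maximal (fun (w : ↥(bdP q)) (hw : q w.1 ∈ U₁ m) => mem_face_of_mem_U₁ hw w.2)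
        (isOpen_U₁.preimage hqc) h)
    · refine Or.inl (interior_maximal (fun (w : ↥(bdP q)) (hw : q w.1 ∈ U₂ m) => mem_jbPlus_of_mem_U₂ hw w.2)
        (isOpen_U₂.preimage hqc) h)
  have hexc := relativeSingularHomology.isIso_map_of_interior_union_interior_holds R R ↥(bdP q) A B hcov n
  -- `faceIncl = subsetIncl B ∘ e` for the homeomorphism `e : q⁻¹face ≅ B`
  let e : FaceP q ≃ₜ ↥B :=
    (preimageValHomeomorphOfSubset (preimage_mono face_subset_boundary : q ⁻¹' face m ⊆ bdP q)).symm
  have he : MapsTo e (Subtype.val ⁻¹' (q ⁻¹' jbPlus m)) (Subtype.val ⁻¹' A) := fun z hz => hz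
  have he' : MapsTo e.symm (Subtype.val ⁻¹' A) (Subtype.val ⁻¹' (q ⁻¹' jbPlus m)) := fun z hz => hz
  have hfac : faceIncl q = (subsetIncl B).comp (e : C(FaceP q, ↥B)) := by ext z; rfl
  have hcomp : relativeSingularHomology.map R R (faceIncl q) (mapsTo_faceIncl_plus (q := q)) n =
      relativeSingularHomology.map R R (e : C(FaceP q, ↥B)) he n ≫
        relativeSingularHomology.map R R (subsetIncl B) (Set.mapsTo_preimage Subtype.val A) n := by
    rw [← relativeSingularHomology.map_comp]
    exact relativeSingularHomology.map_congr R R hfac _ _ n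
  haveI := relativeSingularHomology.isIso_map_homeomorph R R e he he' n
  rw [hcomp]
  infer_instance

/-- **`ι : H_n(q⁻¹face, q⁻¹(face ∩ J)) ≅ H_n(q⁻¹∂, q⁻¹J)`**, induced by the inclusion of pairs.
[cite: Spanier1981, Ch. 9, Sec. 2, Lemma 2 (proof: homotopy and excision)] -/
theorem isIso_ι (hq : IsSerreFibration q) (n : ℕ) :
    IsIso (relativeSingularHomology.map R R (faceIncl q) (mapsTo_faceIncl (q := q)) n) := by
  haveI := isIso_jplus R hq n
  haveI := isIso_kplus R hq n
  haveI := isIso_exc R hq n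
  have hsq : relativeSingularHomology.map R R (faceIncl q) (mapsTo_faceIncl (q := q)) n ≫
      relativeSingularHomology.map R R (ContinuousMap.id ↥(bdP q)) (mapsTo_id_of_subset (jb_sub_plus_bd (q := q))) n =
      relativeSingularHomology.map R R (ContinuousMap.id (FaceP q)) (mapsTo_id_of_subset (jb_sub_plus_face (q := q))) n ≫
        relativeSingularHomology.map R R (faceIncl q) (mapsTo_faceIncl_plus (q := q)) n := by
    rw [← relativeSingularHomology.map_comp, ← relativeSingularHomology.map_comp]
    exact relativeSingularHomology.map_congr R R rfl _ _ n
  haveI : IsIso (relativeSingularHomology.map R R (faceIncl q) (mapsTo_faceIncl (q := q)) n ≫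
      relativeSingularHomology.map R R (ContinuousMap.id ↥(bdP q)) (mapsTo_id_of_subset (jb_sub_plus_bd (q := q))) n) := by
    rw [hsq]; infer_instance
  exact IsIso.of_isIso_comp_right (relativeSingularHomology.map R R (faceIncl q) (mapsTo_faceIncl (q := q)) n)
    (relativeSingularHomology.map R R (ContinuousMap.id ↥(bdP q)) (mapsTo_id_of_subset (jb_sub_plus_bd (q := q))) n)

end Fibration


/-! ### The free face is a Serre fibration over `Iᵐ`; fibrewise maps -/

/-- Post-composing a Serre fibration with a homeomorphism of the base gives a Serre fibration.
[cite: HatcherAT2002, §4.2 p. 376] -/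
theorem _root_.Literature.AlgebraicTopology.Homotopy.IsSerreFibration.homeomorph_comp
    {E : Type*} {B B' : Type*} [TopologicalSpace E] [TopologicalSpace B] [TopologicalSpace B']
    {p : E → B} (hp : IsSerreFibration p) (e : B ≃ₜ B') : IsSerreFibration (e ∘ p) := by
  refine ⟨e.continuous.comp hp.continuous, fun k K g hg hgK => ?_⟩
  obtain ⟨G, hGK, hGg⟩ := hp.exists_homotopy_lift_rel ((e.symm : C(B', B)).comp K) g hg (fun z hz => by
    show p (g z) = e.symm (K z)
    rw [← hgK z hz]; exact (e.symm_apply_apply _).symm)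
  exact ⟨G, fun z => by show e (p (G z)) = K z; rw [hGK z]; exact e.apply_symm_apply _, hGg⟩

section Face

variable (R : Type uR) [CommRing R]
variable {P P' : Type u} [TopologicalSpace P] [TopologicalSpace P']
  {q : P → (Fin (m + 1) → I)} {q' : P' → (Fin (m + 1) → I)}

/-- **The free-face fibration**: `e ↦ tail (q e)` on `q⁻¹(free face)`. [cite: Spanier1981, Ch. 9, Sec. 2, Thm. 15 (a) (proof)] -/
def faceMap (q : P → (Fin (m + 1) → I)) : FaceP q → (Fin m → I) := fun e => Fin.tail (q e.1)

omit [TopologicalSpace P] in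
/-- The formula for `faceMap`. [folklore] -/
theorem faceMap_apply (e : FaceP q) : faceMap q e = Fin.tail (q e.1) := rfl

/-- The free-face fibration is a Serre fibration. [cite: HatcherAT2002, §4.2 p. 376] -/
theorem isSerreFibration_faceMap (hq : IsSerreFibration q) : IsSerreFibration (faceMap q) := by
  have h : faceMap q = (faceHomeomorph m) ∘ (face m).restrictPreimage q := rfl
  rw [h]
  exact (hq.restrictPreimage (face m)).homeomorph_comp (faceHomeomorph m)

omit [TopologicalSpace P] in
/-- Its boundary preimage is `q⁻¹(face ∩ J)`. [folklore] -/
theorem faceMap_preimage_boundary :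
    (faceMap q) ⁻¹' Cube.boundary (Fin m) = Subtype.val ⁻¹' (q ⁻¹' jb m) := by
  ext e
  exact (mem_jb_iff_of_mem_face e.2).symm

/-- The inclusion `q⁻¹(face) → P`. [folklore] -/
def faceVal (q : P → (Fin (m + 1) → I)) : C(FaceP q, P) := ⟨Subtype.val, continuous_subtype_val⟩

/-- **`q⁻¹(face) ↪ P` is a weak homotopy equivalence** (the face is a weakly contractible
sub-base of the weakly contractible cube). [cite: Spanier1981, Ch. 9, Sec. 2, Thm. 17] -/
theorem isWeakHomotopyEquiv_faceVal (hq : IsSerreFibration q) : IsWeakHomotopyEquiv (faceVal q) := by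
  have h := hq.isWeakHomotopyEquiv_preimage_inclusion (subset_univ (face m)) isWeakHomotopyEquiv_face_univ
  have hfac : faceVal q = ((Homeomorph.Set.univ P : ↥(univ : Set P) ≃ₜ P) : C(↥(univ : Set P), P)).comp
      (subsetInclusion (preimage_mono (subset_univ (face m)) : q ⁻¹' face m ⊆ q ⁻¹' univ)) := by
    ext; rfl
  rw [hfac]
  exact (IsWeakHomotopyEquiv.of_homeomorph _).comp h

/-- A fibrewise map preserves the preimage of every sub-base. [folklore] -/
theorem mapsTo_preimage_of_fibrewise (f : C(P, P')) (hf : ∀ e, q' (f e) = q e) (S : Set (Fin (m + 1) → I)) :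
    MapsTo f (q ⁻¹' S) (q' ⁻¹' S) :=
  fun e he => by show q' (f e) ∈ S; rw [hf]; exact he

/-- The fibrewise map restricted to the free faces. [folklore] -/
def faceRestrict (f : C(P, P')) (hf : ∀ e, q' (f e) = q e) : C(FaceP q, FaceP q') :=
  ⟨fun e => ⟨f e.1, mapsTo_preimage_of_fibrewise f hf (face m) e.2⟩, (f.continuous.comp continuous_subtype_val).subtype_mk _⟩

/-- The restricted map is fibrewise over `Iᵐ`. [folklore] -/
theorem faceMap_faceRestrict (f : C(P, P')) (hf : ∀ e, q' (f e) = q e) (e : FaceP q) :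
    faceMap q' (faceRestrict f hf e) = faceMap q e := by
  show Fin.tail (q' (f e.1)) = Fin.tail (q e.1)
  rw [hf]

/-- The restricted map respects the boundary preimages of the faces. [folklore] -/
theorem mapsTo_faceRestrict (f : C(P, P')) (hf : ∀ e, q' (f e) = q e) :
    MapsTo (faceRestrict f hf) (Subtype.val ⁻¹' (q ⁻¹' jb m)) (Subtype.val ⁻¹' (q' ⁻¹' jb m)) :=
  fun e he => by show q' (f e.1) ∈ jb m; rw [hf]; exact he

/-- The restriction to `q⁻¹∂` respects `q⁻¹J`. [folklore] -/
theorem mapsTo_subsetRestrict_bd (f : C(P, P')) (hf : ∀ e, q' (f e) = q e) :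
    MapsTo (subsetRestrict f (mapsTo_preimage_of_fibrewise f hf (Cube.boundary (Fin (m + 1)))))
      (Subtype.val ⁻¹' (jbP q)) (Subtype.val ⁻¹' (jbP q')) :=
  fun e he => by show q' (f e.1) ∈ jb m; rw [hf]; exact he

/-- Naturality of `δ` under fibrewise maps. [cite: HatcherAT2002, §2.1 p. 127 (naturality)] -/
theorem tripleδ_natural (f : C(P, P')) (hf : ∀ e, q' (f e) = q e) (n : ℕ) :
    relativeSingularHomology.map R R f (mapsTo_preimage_of_fibrewise f hf (Cube.boundary (Fin (m + 1)))) (n + 1) ≫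
        relativeSingularHomology.tripleδ R R P' (bdP q') (jbP q') n =
      relativeSingularHomology.tripleδ R R P (bdP q) (jbP q) n ≫
        relativeSingularHomology.map R R (subsetRestrict f (mapsTo_preimage_of_fibrewise f hf _))
          (mapsTo_subsetRestrict_bd f hf) n := by
  rw [relativeSingularHomology.tripleδ, relativeSingularHomology.tripleδ, Category.assoc,
    relativeSingularHomology.ofAbsolute_comp_map, ← Category.assoc,
    ← relativeSingularHomology.δ_naturality, Category.assoc]

/-- Naturality of `ι` under fibrewise maps. [folklore] -/
theorem ι_natural (f : C(P, P')) (hf : ∀ e, q' (f e) = q e) (n : ℕ) :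
    relativeSingularHomology.map R R (faceIncl q) (mapsTo_faceIncl (q := q)) n ≫
        relativeSingularHomology.map R R (subsetRestrict f (mapsTo_preimage_of_fibrewise f hf _))
          (mapsTo_subsetRestrict_bd f hf) n =
      relativeSingularHomology.map R R (faceRestrict f hf) (mapsTo_faceRestrict f hf) n ≫
        relativeSingularHomology.map R R (faceIncl q') (mapsTo_faceIncl (q := q')) n := by
  rw [← relativeSingularHomology.map_comp, ← relativeSingularHomology.map_comp]
  exact relativeSingularHomology.map_congr R R (by ext e; rfl) _ _ n

/-- Naturality of the face inclusions under fibrewise maps. [folklore] -/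
theorem faceVal_natural (f : C(P, P')) (hf : ∀ e, q' (f e) = q e) (n : ℕ) :
    singularHomology.map R R (faceRestrict f hf) n ≫ singularHomology.map R R (faceVal q') n =
      singularHomology.map R R (faceVal q) n ≫ singularHomology.map R R f n := by
  rw [← singularHomology.map_comp, ← singularHomology.map_comp]
  rfl

end Face

/-! ### The induction on the dimension of the cube -/

section Main

variable (R : Type uR) [CommRing R]

/-- `∂I⁰ = ∅`. [folklore] -/
theorem boundary_fin_zero : Cube.boundary (Fin 0) = ∅ :=
  eq_empty_of_forall_notMem fun _ ⟨i, _⟩ => i.elim0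

/-- The inductive statement: for a fibrewise map `f` of Serre fibrations over `Iᵈ`, `f_*` on
`H_{k+d}(P, q⁻¹∂Iᵈ)` is an isomorphism / onto / injective iff `f_*` on `H_k(P)` is.
[cite: Spanier1981, Ch. 9, Sec. 2, Thm. 15 (a)] -/
theorem main_aux : ∀ (d : ℕ) {P P' : Type u} [TopologicalSpace P] [TopologicalSpace P']
    {q : P → (Fin d → I)} {q' : P' → (Fin d → I)} (_ : IsSerreFibration q) (_ : IsSerreFibration q')
    (f : C(P, P')) (_ : ∀ e, q' (f e) = q e) {A : Set P} {A' : Set P'}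
    (_ : A = q ⁻¹' Cube.boundary (Fin d)) (_ : A' = q' ⁻¹' Cube.boundary (Fin d)) (hfA : MapsTo f A A') (k : ℕ),
    (IsIso (singularHomology.map R R f k) ↔ IsIso (relativeSingularHomology.map R R f hfA (k + d))) ∧
    (Epi (singularHomology.map R R f k) ↔ Epi (relativeSingularHomology.map R R f hfA (k + d))) ∧
    (Mono (singularHomology.map R R f k) ↔ Mono (relativeSingularHomology.map R R f hfA (k + d))) := by
  intro d
  induction d with
  | zero =>
    intro P P' _ _ q q' hq hq' f hf A A' hA hA' hfA k
    subst hA hA'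
    haveI : IsEmpty ↥(q ⁻¹' Cube.boundary (Fin 0)) := ⟨fun z => by
      obtain ⟨i, -⟩ := (z.2 : q z.1 ∈ Cube.boundary (Fin 0)); exact i.elim0⟩
    haveI : IsEmpty ↥(q' ⁻¹' Cube.boundary (Fin 0)) := ⟨fun z => by
      obtain ⟨i, -⟩ := (z.2 : q' z.1 ∈ Cube.boundary (Fin 0)); exact i.elim0⟩
    haveI := relativeSingularHomology.isIso_ofAbsolute_of_isEmpty R R (X := P) (q ⁻¹' Cube.boundary (Fin 0)) k
    haveI := relativeSingularHomology.isIso_ofAbsolute_of_isEmpty R R (X := P') (q' ⁻¹' Cube.boundary (Fin 0)) k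
    have sq := (relativeSingularHomology.ofAbsolute_comp_map R R f hfA k).symm
    exact ⟨isIso_iff_of_square _ _ sq, epi_iff_of_square _ _ sq, mono_iff_of_square _ _ sq⟩
  | succ m ih =>
    intro P P' _ _ q q' hq hq' f hf A A' hA hA' hfA k
    subst hA hA'
    -- (1) along `δ`
    haveI := isIso_tripleδ R hq (k + m)
    haveI := isIso_tripleδ R hq' (k + m)
    have sq1 := tripleδ_natural R f hf (k + m)
    have e1 := isIso_iff_of_square _ _ sq1
    have e1' := epi_iff_of_square _ _ sq1
    have e1'' := mono_iff_of_square _ _ sq1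
    -- (2) along `ι`
    haveI := isIso_ι R hq (k + m)
    haveI := isIso_ι R hq' (k + m)
    have sq2 := (ι_natural R f hf (k + m)).symm
    have e2 := isIso_iff_of_square _ _ sq2
    have e2' := epi_iff_of_square _ _ sq2
    have e2'' := mono_iff_of_square _ _ sq2
    -- (3) induction hypothesis for the free-face fibrations
    have e3 := ih (isSerreFibration_faceMap hq) (isSerreFibration_faceMap hq') (faceRestrict f hf)
      (faceMap_faceRestrict f hf) faceMap_preimage_boundary.symm faceMap_preimage_boundary.symm
      (mapsTo_faceRestrict f hf) k
    -- (4) the face total spaces include by weak equivalences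
    haveI := isIso_singularHomology_map_of_isWeakHomotopyEquiv (R := R) (faceVal q) (isWeakHomotopyEquiv_faceVal hq) k
    haveI := isIso_singularHomology_map_of_isWeakHomotopyEquiv (R := R) (faceVal q') (isWeakHomotopyEquiv_faceVal hq') k
    have sq4 := faceVal_natural R f hf k
    have e4 := isIso_iff_of_square _ _ sq4
    have e4' := epi_iff_of_square _ _ sq4
    have e4'' := mono_iff_of_square _ _ sq4
    refine ⟨?_, ?_, ?_⟩
    · exact e4.symm.trans (e3.1.trans (e2.trans e1.symm))
    · exact e4'.symm.trans (e3.2.1.trans (e2'.trans e1'.symm))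
    · exact e4''.symm.trans (e3.2.2.trans (e2''.trans e1''.symm))

/-- The inductive vanishing statement. [cite: Spanier1981, Ch. 9, Sec. 2, Thm. 15 (a)] -/
theorem isZero_aux : ∀ (d : ℕ) {P : Type u} [TopologicalSpace P] {q : P → (Fin d → I)} (_ : IsSerreFibration q)
    {A : Set P} (_ : A = q ⁻¹' Cube.boundary (Fin d)) (n : ℕ), n < d →
    IsZero (relativeSingularHomology R R P A n) := by
  intro d
  induction d with
  | zero => intro P _ q hq A hA n hn; exact absurd hn (Nat.not_lt_zero n)
  | succ m ih =>
    intro P _ q hq A hA n hn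
    subst hA
    cases n with
    | zero =>
      -- `H₀(P, q⁻¹J) → H₀(P, q⁻¹∂)` is onto and its source vanishes
      haveI := relativeSingularHomology.epi_ofAbsolute_zero R R (X := P) (bdP q)
      have hfac : relativeSingularHomology.ofAbsolute R R P (jbP q) 0 ≫
          relativeSingularHomology.map R R (ContinuousMap.id P) (mapsTo_id_of_subset (jbP_subset_bdP (q := q))) 0 =
          relativeSingularHomology.ofAbsolute R R P (bdP q) 0 := by
        rw [relativeSingularHomology.ofAbsolute_comp_map, singularHomology.map_id, Category.id_comp]
      haveI := epi_of_epi_fac hfac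
      exact (isZero_rel_jbP R hq 0).of_epi
        (relativeSingularHomology.map R R (ContinuousMap.id P) (mapsTo_id_of_subset (jbP_subset_bdP (q := q))) 0)
    | succ n =>
      haveI := isIso_tripleδ R hq n
      haveI := isIso_ι R hq n
      have hz := ih (isSerreFibration_faceMap hq) faceMap_preimage_boundary.symm n (by omega)
      exact (hz.of_iso (asIso (relativeSingularHomology.map R R (faceIncl q) (mapsTo_faceIncl (q := q)) n)).symm).of_iso
        (asIso (relativeSingularHomology.tripleδ R R P (bdP q) (jbP q) n))

variable {d : ℕ} {P P' : Type u} [TopologicalSpace P] [TopologicalSpace P']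
  {q : P → (Fin d → I)} {q' : P' → (Fin d → I)}

/-- **`H_n(P, q⁻¹∂Iᵈ; R) = 0` for `n < d`** for a Serre fibration over the cube `Iᵈ`.
[cite: Spanier1981, Ch. 9, Sec. 2, Thm. 15 (a)] -/
theorem isZero_of_lt (hq : IsSerreFibration q) {n : ℕ} (hn : n < d) :
    IsZero (relativeSingularHomology R R P (q ⁻¹' Cube.boundary (Fin d)) n) :=
  isZero_aux R d hq rfl n hn

/-- A fibrewise map respects the boundary preimages. [folklore] -/
theorem mapsTo_bd (f : C(P, P')) (hf : ∀ e, q' (f e) = q e) :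
    MapsTo f (q ⁻¹' Cube.boundary (Fin d)) (q' ⁻¹' Cube.boundary (Fin d)) :=
  fun e he => by show q' (f e) ∈ Cube.boundary (Fin d); rw [hf]; exact he

/-- **Spanier's Thm. 9.2.15 (a) for Serre fibrations, naturality form — isomorphisms.** For a
fibrewise map `f : P → P'` of Serre fibrations over the cube `Iᵈ`,
`f_* : H_{k+d}(P, q⁻¹∂Iᵈ) → H_{k+d}(P', q'⁻¹∂Iᵈ)` is an isomorphism iff `f_* : H_k(P) → H_k(P')` is.
[cite: Spanier1981, Ch. 9, Sec. 2, Thm. 15 (a)] -/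
theorem isIso_map_iff (hq : IsSerreFibration q) (hq' : IsSerreFibration q') (f : C(P, P'))
    (hf : ∀ e, q' (f e) = q e) (k : ℕ) :
    IsIso (relativeSingularHomology.map R R f (mapsTo_bd f hf) (k + d)) ↔ IsIso (singularHomology.map R R f k) :=
  (main_aux R d hq hq' f hf rfl rfl (mapsTo_bd f hf) k).1.symm

/-- **Spanier's Thm. 9.2.15 (a) for Serre fibrations, naturality form — epimorphisms.**
[cite: Spanier1981, Ch. 9, Sec. 2, Thm. 15 (a)] -/
theorem epi_map_iff (hq : IsSerreFibration q) (hq' : IsSerreFibration q') (f : C(P, P'))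
    (hf : ∀ e, q' (f e) = q e) (k : ℕ) :
    Epi (relativeSingularHomology.map R R f (mapsTo_bd f hf) (k + d)) ↔ Epi (singularHomology.map R R f k) :=
  (main_aux R d hq hq' f hf rfl rfl (mapsTo_bd f hf) k).2.1.symm

/-- **Spanier's Thm. 9.2.15 (a) for Serre fibrations, naturality form — monomorphisms.**
[cite: Spanier1981, Ch. 9, Sec. 2, Thm. 15 (a)] -/
theorem mono_map_iff (hq : IsSerreFibration q) (hq' : IsSerreFibration q') (f : C(P, P'))
    (hf : ∀ e, q' (f e) = q e) (k : ℕ) :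
    Mono (relativeSingularHomology.map R R f (mapsTo_bd f hf) (k + d)) ↔ Mono (singularHomology.map R R f k) :=
  (main_aux R d hq hq' f hf rfl rfl (mapsTo_bd f hf) k).2.2.symm

end Main

end SerreCube

end Literature.AlgebraicTopology.Homotopy

end
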